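import Summits.RiemannHypothesis.RiemannHypothesis.Theorems.LaplaceLoophole.Negative.LaplaceLoopholeThetaSign

/-!
# RiemannHypothesis / UniversalFactor — Lipschitz control of the theta series `Φ_ℂ(iy)` in `y`
(negative-side support for crux `LaplaceLoophole`, item stmt-RiemannHypothesis-2575)

Analysis layer for interval certificates of the SIGN of `Re Φ_ℂ(iy)` on whole `y`-cells (sequel
`LaplaceLoopholeThetaGrid.lean`): with `s_m(y) = term m y` the terms of `Φ_ℂ(iy)`,

* `hasDerivAt_term`, `norm_termDeriv_le` — `‖∂_y s_m(y)‖ ≤ (8π³m⁶ + 30π²m⁴ + 15πm²) e^{−πm² cos 4y}`;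
* `norm_sum_term_sub_le` — Lipschitz bound for the partial sums on a cell where `cos 4t ≥ c`
  (mean value inequality);
* `tsum_norm_term_tail_le'` — general tail `Σ_{m ≥ N₀} ‖s_m‖ ≤ 10⁻⁷` for `N₀ ≥ 13`, `cos 4y ≥ c₀ > 0`,
  `π c₀ N₀ ≥ 8`;
* `re_tsum_pos_on_cell` / `re_tsum_neg_on_cell` — the sign of `Re Φ_ℂ(iy)` on a whole cell from an
  enclosure at its midpoint, a Lipschitz constant and the tail.
-/

noncomputable section

/-! ## Lipschitz control of the theta series in `y` (for interval certificates over `y`-cells) -/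

namespace Summit.RiemannHypothesis.RiemannHypothesis.Theorems

open Complex Real Finset Set

namespace UniversalFactor.PhiICert

/-- The `y`-derivative of `term m y`. [folklore] -/
def termDeriv (m : ℕ) (y : ℝ) : ℂ :=
  ((9 * (2 * π ^ 2 * (m : ℂ) ^ 4) * cexp (9 * (I * y)) - 5 * (3 * π * (m : ℂ) ^ 2) * cexp (5 * (I * y))) -
      (2 * π ^ 2 * (m : ℂ) ^ 4 * cexp (9 * (I * y)) - 3 * π * (m : ℂ) ^ 2 * cexp (5 * (I * y))) *
        (4 * (π * (m : ℂ) ^ 2 * cexp (4 * (I * y))))) *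
    cexp (-(π * (m : ℂ) ^ 2 * cexp (4 * (I * y)))) * I

/-- The Lipschitz coefficient `8π³m⁶ + 30π²m⁴ + 15πm²`. [folklore] -/
def dco (m : ℕ) : ℝ := 8 * π ^ 3 * (m : ℝ) ^ 6 + 30 * π ^ 2 * (m : ℝ) ^ 4 + 15 * π * (m : ℝ) ^ 2

/-- `d/dy e^{c·iy} = e^{c·iy}·(c i)`. [folklore] -/
theorem hasDerivAt_cexp_mul_I (c : ℂ) (y : ℝ) :
    HasDerivAt (fun y : ℝ ↦ cexp (c * (I * y))) (cexp (c * (I * y)) * (c * I)) y := by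
  have hy : HasDerivAt (fun y : ℝ ↦ ((y : ℝ) : ℂ)) 1 y := by
    simpa using (hasDerivAt_id y).ofReal_comp
  have h1 : HasDerivAt (fun y : ℝ ↦ c * (I * ((y : ℝ) : ℂ))) (c * (I * 1)) y := (hy.const_mul I).const_mul c
  simpa using h1.cexp

/-- `term m` is differentiable in `y` with derivative `termDeriv m y`. [folklore] -/
theorem hasDerivAt_term (m : ℕ) (y : ℝ) : HasDerivAt (fun y : ℝ ↦ term m y) (termDeriv m y) y := by
  have h9 := hasDerivAt_cexp_mul_I 9 y
  have h5 := hasDerivAt_cexp_mul_I 5 y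
  have h4 := hasDerivAt_cexp_mul_I 4 y
  have hP := (h9.const_mul (2 * (π : ℂ) ^ 2 * (m : ℂ) ^ 4)).sub (h5.const_mul (3 * (π : ℂ) * (m : ℂ) ^ 2))
  have hG := ((h4.const_mul ((π : ℂ) * (m : ℂ) ^ 2)).neg).cexp
  have h := hP.mul hG
  refine h.congr_deriv ?_
  simp only [termDeriv, Pi.neg_apply, Pi.sub_apply]
  ring

/-- `‖termDeriv m y‖ ≤ dco m · e^{−πm² cos 4y}`. [folklore] -/
theorem norm_termDeriv_le (m : ℕ) (y : ℝ) :
    ‖termDeriv m y‖ ≤ dco m * Real.exp (-(π * (m : ℝ) ^ 2 * Real.cos (4 * y))) := by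
  have h9 : ‖cexp (9 * (I * y))‖ = 1 := by rw [Complex.norm_exp]; simp
  have h5 : ‖cexp (5 * (I * y))‖ = 1 := by rw [Complex.norm_exp]; simp
  have h4 : ‖cexp (4 * (I * y))‖ = 1 := by rw [Complex.norm_exp]; simp
  have hm : ‖(m : ℂ)‖ = (m : ℝ) := by simp
  have hG : ‖cexp (-(π * (m : ℂ) ^ 2 * cexp (4 * (I * y))))‖ =
      Real.exp (-(π * (m : ℝ) ^ 2 * Real.cos (4 * y))) := by
    rw [Complex.norm_exp]
    congr 1
    have e1 : (π : ℂ) * (m : ℂ) ^ 2 = ((π * (m : ℝ) ^ 2 : ℝ) : ℂ) := by push_cast; ring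
    have e2 : (cexp (4 * (I * (y : ℂ)))).re = Real.cos (4 * y) := by
      rw [show (4 * (I * (y : ℂ))) = ((4 * y : ℝ) : ℂ) * I by push_cast; ring, Complex.exp_ofReal_mul_I_re]
    rw [neg_re, e1, Complex.re_ofReal_mul, e2]
  have hA : ‖9 * (2 * (π : ℂ) ^ 2 * (m : ℂ) ^ 4) * cexp (9 * (I * y)) -
      5 * (3 * π * (m : ℂ) ^ 2) * cexp (5 * (I * y))‖ ≤ 18 * π ^ 2 * (m : ℝ) ^ 4 + 15 * π * (m : ℝ) ^ 2 := by
    refine (norm_sub_le _ _).trans (le_of_eq ?_)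
    simp only [norm_mul, norm_pow, hm, h9, h5, Complex.norm_real, Real.norm_eq_abs,
      abs_of_pos Real.pi_pos, Complex.norm_ofNat, mul_one]
    ring
  have hB : ‖(2 * (π : ℂ) ^ 2 * (m : ℂ) ^ 4 * cexp (9 * (I * y)) - 3 * π * (m : ℂ) ^ 2 * cexp (5 * (I * y))) *
      (4 * (π * (m : ℂ) ^ 2 * cexp (4 * (I * y))))‖ ≤
      (2 * π ^ 2 * (m : ℝ) ^ 4 + 3 * π * (m : ℝ) ^ 2) * (4 * (π * (m : ℝ) ^ 2)) := by
    rw [norm_mul]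
    refine mul_le_mul ((norm_sub_le _ _).trans (le_of_eq ?_)) (le_of_eq ?_) (norm_nonneg _) (by positivity)
    · simp only [norm_mul, norm_pow, hm, h9, h5, Complex.norm_real, Real.norm_eq_abs,
        abs_of_pos Real.pi_pos, Complex.norm_ofNat, mul_one]
    · simp only [norm_mul, norm_pow, hm, h4, Complex.norm_real, Real.norm_eq_abs,
        abs_of_pos Real.pi_pos, Complex.norm_ofNat, mul_one]
  rw [termDeriv, norm_mul, norm_mul, Complex.norm_I, mul_one, hG]
  refine mul_le_mul_of_nonneg_right ?_ (Real.exp_pos _).le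
  refine (norm_sub_le _ _).trans ?_
  have : 18 * π ^ 2 * (m : ℝ) ^ 4 + 15 * π * (m : ℝ) ^ 2 +
      (2 * π ^ 2 * (m : ℝ) ^ 4 + 3 * π * (m : ℝ) ^ 2) * (4 * (π * (m : ℝ) ^ 2)) = dco m := by
    simp only [dco]; ring
  linarith

/-- **Lipschitz bound on a cell**: if `cos 4t ≥ c` on `[y₁, y₂]` then for `y, y'` in the cell
`‖s_m(y) − s_m(y')‖ ≤ dco m · e^{−πm²c} · |y − y'|`. [folklore] -/
theorem norm_term_sub_le {m : ℕ} {y₁ y₂ c : ℝ} (hcos : ∀ t ∈ Icc y₁ y₂, c ≤ Real.cos (4 * t))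
    {y y' : ℝ} (hy : y ∈ Icc y₁ y₂) (hy' : y' ∈ Icc y₁ y₂) :
    ‖term m y - term m y'‖ ≤ dco m * Real.exp (-(π * (m : ℝ) ^ 2 * c)) * |y - y'| := by
  have hdiff : ∀ t ∈ Icc y₁ y₂, DifferentiableAt ℝ (fun y : ℝ ↦ term m y) t :=
    fun t _ ↦ (hasDerivAt_term m t).differentiableAt
  have hbound : ∀ t ∈ Icc y₁ y₂, ‖deriv (fun y : ℝ ↦ term m y) t‖ ≤ dco m * Real.exp (-(π * (m : ℝ) ^ 2 * c)) := by
    intro t ht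
    rw [(hasDerivAt_term m t).deriv]
    refine (norm_termDeriv_le m t).trans ?_
    have hdco : 0 ≤ dco m := by simp only [dco]; positivity
    refine mul_le_mul_of_nonneg_left (Real.exp_le_exp.2 ?_) hdco
    have h0 : 0 ≤ π * (m : ℝ) ^ 2 := by positivity
    nlinarith [hcos t ht]
  have h := (convex_Icc y₁ y₂).norm_image_sub_le_of_norm_deriv_le hdiff hbound hy' hy
  rw [Real.norm_eq_abs] at h
  exact h

/-- Lipschitz bound for the partial sums. [folklore] -/
theorem norm_sum_term_sub_le (N : ℕ) {y₁ y₂ c : ℝ} (hcos : ∀ t ∈ Icc y₁ y₂, c ≤ Real.cos (4 * t))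
    {y y' : ℝ} (hy : y ∈ Icc y₁ y₂) (hy' : y' ∈ Icc y₁ y₂) :
    ‖∑ n ∈ Finset.range N, term (n + 1) y - ∑ n ∈ Finset.range N, term (n + 1) y'‖ ≤
      (∑ n ∈ Finset.range N, dco (n + 1) * Real.exp (-(π * ((n + 1 : ℕ) : ℝ) ^ 2 * c))) * |y - y'| := by
  rw [← Finset.sum_sub_distrib, Finset.sum_mul]
  refine (norm_sum_le _ _).trans (Finset.sum_le_sum fun n _ ↦ ?_)
  exact norm_term_sub_le hcos hy hy'

/-! ## A general tail bound -/

/-- For `m ≥ N₀ ≥ 13`, `cos 4y ≥ c₀ > 0` and `π c₀ N₀ ≥ 8`: `‖s_m(y)‖ ≤ 30 e^{−4m}`. [folklore] -/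
theorem norm_term_le_of_cos' {N₀ m : ℕ} (hN : 13 ≤ N₀) (hm : N₀ ≤ m) {c₀ y : ℝ} (hc₀ : 0 < c₀)
    (h8 : 8 ≤ π * c₀ * N₀) (hc : c₀ ≤ Real.cos (4 * y)) :
    ‖term m y‖ ≤ 30 * Real.exp (-4 * (m : ℝ)) := by
  have hm' : (N₀ : ℝ) ≤ m := by exact_mod_cast hm
  have h13 : (13 : ℝ) ≤ N₀ := by exact_mod_cast hN
  have hπ := Real.pi_gt_d2
  have hπ' := Real.pi_lt_d2
  refine (norm_term_le m y).trans ?_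
  have h1 : 2 * π ^ 2 * (m : ℝ) ^ 4 + 3 * π * (m : ℝ) ^ 2 ≤ 30 * (m : ℝ) ^ 4 := by
    have hm2 : (m : ℝ) ^ 2 ≤ (m : ℝ) ^ 4 := by
      have : (1 : ℝ) ≤ (m : ℝ) ^ 2 := by nlinarith
      nlinarith
    have h3 : 3 * π * (m : ℝ) ^ 2 ≤ 3 * π * (m : ℝ) ^ 4 :=
      mul_le_mul_of_nonneg_left hm2 (by positivity)
    have hπ2 : π ^ 2 < 3.15 ^ 2 := by nlinarith [Real.pi_pos]
    have hc30 : 2 * π ^ 2 + 3 * π ≤ 30 := by nlinarith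
    have hm4 : 0 ≤ (m : ℝ) ^ 4 := by positivity
    calc 2 * π ^ 2 * (m : ℝ) ^ 4 + 3 * π * (m : ℝ) ^ 2 ≤ 2 * π ^ 2 * (m : ℝ) ^ 4 + 3 * π * (m : ℝ) ^ 4 := by
          linarith
      _ = (2 * π ^ 2 + 3 * π) * (m : ℝ) ^ 4 := by ring
      _ ≤ 30 * (m : ℝ) ^ 4 := mul_le_mul_of_nonneg_right hc30 hm4
  have h2 : Real.exp (-(π * (m : ℝ) ^ 2 * Real.cos (4 * y))) ≤ Real.exp (-(π * c₀ * (m : ℝ) ^ 2)) := by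
    apply Real.exp_le_exp.2
    have h0 : 0 ≤ π * (m : ℝ) ^ 2 := by positivity
    nlinarith
  have h3 : (m : ℝ) ^ 4 ≤ Real.exp (4 * ((m : ℝ) - 1)) := by
    have h := Real.add_one_le_exp ((m : ℝ) - 1)
    have h' : (m : ℝ) ≤ Real.exp ((m : ℝ) - 1) := by linarith
    calc (m : ℝ) ^ 4 ≤ (Real.exp ((m : ℝ) - 1)) ^ 4 := by gcongr
      _ = Real.exp (4 * ((m : ℝ) - 1)) := by rw [← Real.exp_nat_mul]; norm_num
  -- `π c₀ m² ≥ 8 m`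
  have hkey : 8 * (m : ℝ) ≤ π * c₀ * (m : ℝ) ^ 2 := by
    have : 8 * (m : ℝ) ≤ π * c₀ * (N₀ : ℝ) * (m : ℝ) := by nlinarith
    have : π * c₀ * (N₀ : ℝ) * (m : ℝ) ≤ π * c₀ * (m : ℝ) * (m : ℝ) := by
      have : 0 ≤ π * c₀ * (m : ℝ) := by positivity
      nlinarith
    nlinarith
  have h4 : 30 * (m : ℝ) ^ 4 * Real.exp (-(π * c₀ * (m : ℝ) ^ 2)) ≤ 30 * Real.exp (-4 * (m : ℝ)) := by
    have h5 : Real.exp (4 * ((m : ℝ) - 1)) * Real.exp (-(π * c₀ * (m : ℝ) ^ 2)) ≤ Real.exp (-4 * (m : ℝ)) := by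
      rw [← Real.exp_add]
      apply Real.exp_le_exp.2
      nlinarith
    calc 30 * (m : ℝ) ^ 4 * Real.exp (-(π * c₀ * (m : ℝ) ^ 2))
        ≤ 30 * Real.exp (4 * ((m : ℝ) - 1)) * Real.exp (-(π * c₀ * (m : ℝ) ^ 2)) := by gcongr
      _ = 30 * (Real.exp (4 * ((m : ℝ) - 1)) * Real.exp (-(π * c₀ * (m : ℝ) ^ 2))) := by ring
      _ ≤ 30 * Real.exp (-4 * (m : ℝ)) := by gcongr
  calc (2 * π ^ 2 * (m : ℝ) ^ 4 + 3 * π * (m : ℝ) ^ 2) * Real.exp (-(π * (m : ℝ) ^ 2 * Real.cos (4 * y)))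
      ≤ 30 * (m : ℝ) ^ 4 * Real.exp (-(π * c₀ * (m : ℝ) ^ 2)) :=
        mul_le_mul h1 h2 (Real.exp_pos _).le (by positivity)
    _ ≤ 30 * Real.exp (-4 * (m : ℝ)) := h4

/-- General tail: `Σ_{j≥0} ‖s_{j+N₀}(y)‖ ≤ 10⁻⁷` (`N₀ ≥ 13`, `cos 4y ≥ c₀ > 0`, `π c₀ N₀ ≥ 8`). [folklore] -/
theorem tsum_norm_term_tail_le' {N₀ : ℕ} (hN : 13 ≤ N₀) {c₀ y : ℝ} (hc₀ : 0 < c₀)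
    (h8 : 8 ≤ π * c₀ * N₀) (hc : c₀ ≤ Real.cos (4 * y)) :
    Summable (fun j : ℕ ↦ ‖term (j + N₀) y‖) ∧ ∑' j : ℕ, ‖term (j + N₀) y‖ ≤ 1 / 10 ^ 7 := by
  have hb : ∀ j : ℕ, ‖term (j + N₀) y‖ ≤ 30 * Real.exp (-4 * N₀) * Real.exp (-4) ^ j := by
    intro j
    have h := norm_term_le_of_cos' (m := j + N₀) hN (by omega) hc₀ h8 hc
    have e : 30 * Real.exp (-4 * ((j + N₀ : ℕ) : ℝ)) = 30 * Real.exp (-4 * N₀) * Real.exp (-4) ^ j := by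
      rw [← Real.exp_nat_mul, mul_assoc, ← Real.exp_add]
      congr 1
      push_cast
      ring_nf
    rwa [e] at h
  have hq0 : 0 ≤ Real.exp (-4) := (Real.exp_pos _).le
  obtain ⟨e4, e52⟩ := exp_neg_four_le
  have hq1 : Real.exp (-4) < 1 := by linarith
  have hgeom : Summable (fun j : ℕ ↦ 30 * Real.exp (-4 * N₀) * Real.exp (-4) ^ j) :=
    (summable_geometric_of_lt_one hq0 hq1).mul_left _
  have hs : Summable (fun j : ℕ ↦ ‖term (j + N₀) y‖) :=
    Summable.of_nonneg_of_le (fun _ ↦ norm_nonneg _) hb hgeom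
  refine ⟨hs, ?_⟩
  -- `e^{-4 N₀} ≤ e^{-52} = (e^{-4})^{13} ≤ (1/5)^{13}`
  have h5 : Real.exp (-4) ≤ 1 / 5 := by
    rw [Real.exp_neg, inv_eq_one_div, div_le_div_iff₀ (Real.exp_pos _) (by norm_num)]
    have := Real.add_one_le_exp (4:ℝ)
    linarith
  have hN0 : Real.exp (-4 * (N₀ : ℝ)) ≤ (1 / 5) ^ 13 := by
    have h13 : (13 : ℝ) ≤ N₀ := by exact_mod_cast hN
    calc Real.exp (-4 * (N₀ : ℝ)) ≤ Real.exp (-52) := Real.exp_le_exp.2 (by linarith)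
      _ = Real.exp (-4) ^ 13 := by rw [← Real.exp_nat_mul]; norm_num
      _ ≤ (1 / 5) ^ 13 := by gcongr
  calc ∑' j : ℕ, ‖term (j + N₀) y‖ ≤ ∑' j : ℕ, 30 * Real.exp (-4 * N₀) * Real.exp (-4) ^ j :=
        Summable.tsum_le_tsum hb hs hgeom
    _ = 30 * Real.exp (-4 * N₀) * (1 - Real.exp (-4))⁻¹ := by
        rw [tsum_mul_left, tsum_geometric_of_lt_one hq0 hq1]
    _ ≤ 30 * (1 / 5) ^ 13 * 2 := by
        have hinv : (1 - Real.exp (-4))⁻¹ ≤ 2 := by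
          rw [inv_eq_one_div, div_le_iff₀ (by linarith)]; linarith
        have h30 : 0 ≤ 30 * Real.exp (-4 * (N₀ : ℝ)) := by positivity
        calc 30 * Real.exp (-4 * N₀) * (1 - Real.exp (-4))⁻¹ ≤ 30 * Real.exp (-4 * N₀) * 2 :=
              mul_le_mul_of_nonneg_left hinv h30
          _ ≤ 30 * (1 / 5) ^ 13 * 2 := by nlinarith
    _ ≤ 1 / 10 ^ 7 := by norm_num

/-- Summability of the whole series under the general tail hypotheses. [folklore] -/
theorem summable_term' {N₀ : ℕ} (hN : 13 ≤ N₀) {c₀ y : ℝ} (hc₀ : 0 < c₀)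
    (h8 : 8 ≤ π * c₀ * N₀) (hc : c₀ ≤ Real.cos (4 * y)) :
    Summable (fun n : ℕ ↦ term (n + 1) y) := by
  have h := (tsum_norm_term_tail_le' hN hc₀ h8 hc).1
  obtain ⟨N, rfl⟩ : ∃ N, N₀ = N + 1 := ⟨N₀ - 1, by omega⟩
  have h' : Summable (fun j : ℕ ↦ term (j + N + 1) y) := Summable.of_norm (by simpa [add_assoc] using h)
  exact (summable_nat_add_iff N).1 h'

/-! ## Sign on a whole cell from data at its midpoint -/

/-- **Positivity of `Re Φ_ℂ(iy)` on a cell `[y₁, y₂]`** from: a lower bound `c₀` for `cos 4t` on the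
cell with `π c₀ (N+1) ≥ 8`, `N + 1 ≥ 13`; an upper bound `D` for the Lipschitz constant
`Σ_{m≤N} dco(m) e^{−πm²c₀}`; a lower bound `S` for `Re Σ_{m≤N} s_m` at the midpoint; and
`1/10⁷ + D·(y₂−y₁)/2 < S`. [folklore] -/
theorem re_tsum_pos_on_cell {N : ℕ} (hN : 13 ≤ N + 1) {c₀ : ℝ} (hc₀ : 0 < c₀)
    (h8 : 8 ≤ π * c₀ * ((N + 1 : ℕ) : ℝ)) {y₁ y₂ : ℝ} (h12 : y₁ ≤ y₂)
    (hcos : ∀ t ∈ Icc y₁ y₂, c₀ ≤ Real.cos (4 * t)) {D S : ℝ}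
    (hD : ∑ n ∈ Finset.range N, dco (n + 1) * Real.exp (-(π * ((n + 1 : ℕ) : ℝ) ^ 2 * c₀)) ≤ D)
    (hS : S ≤ (∑ n ∈ Finset.range N, term (n + 1) ((y₁ + y₂) / 2)).re)
    (hmain : 1 / 10 ^ 7 + D * ((y₂ - y₁) / 2) < S) :
    ∀ y ∈ Icc y₁ y₂, 0 < (∑' n : ℕ, term (n + 1) y).re := by
  intro y hy
  have hcy := hcos y hy
  obtain ⟨hsn, htail⟩ := tsum_norm_term_tail_le' hN hc₀ h8 hcy
  have hs := summable_term' hN hc₀ h8 hcy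
  rw [← hs.sum_add_tsum_nat_add N, Complex.add_re]
  have hsn' : Summable (fun n : ℕ ↦ ‖term (n + N + 1) y‖) := by simpa [add_assoc] using hsn
  have ht : |(∑' n : ℕ, term (n + N + 1) y).re| ≤ 1 / 10 ^ 7 :=
    calc |(∑' n : ℕ, term (n + N + 1) y).re| ≤ ‖∑' n : ℕ, term (n + N + 1) y‖ := Complex.abs_re_le_norm _
      _ ≤ ∑' n : ℕ, ‖term (n + N + 1) y‖ := norm_tsum_le_tsum_norm hsn'
      _ = ∑' j : ℕ, ‖term (j + (N + 1)) y‖ := by simp [add_assoc]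
      _ ≤ 1 / 10 ^ 7 := htail
  -- Lipschitz from the midpoint
  have hmid : (y₁ + y₂) / 2 ∈ Icc y₁ y₂ := ⟨by linarith, by linarith⟩
  have hL := norm_sum_term_sub_le N hcos hy hmid
  have hdist : |y - (y₁ + y₂) / 2| ≤ (y₂ - y₁) / 2 := by
    rw [abs_le]; constructor <;> linarith [hy.1, hy.2]
  have hDnn : 0 ≤ ∑ n ∈ Finset.range N, dco (n + 1) * Real.exp (-(π * ((n + 1 : ℕ) : ℝ) ^ 2 * c₀)) :=
    Finset.sum_nonneg fun n _ ↦ by simp only [dco]; positivity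
  have hre : (∑ n ∈ Finset.range N, term (n + 1) ((y₁ + y₂) / 2)).re - D * ((y₂ - y₁) / 2) ≤
      (∑ n ∈ Finset.range N, term (n + 1) y).re := by
    have h1 := Complex.abs_re_le_norm (∑ n ∈ Finset.range N, term (n + 1) y -
      ∑ n ∈ Finset.range N, term (n + 1) ((y₁ + y₂) / 2))
    rw [Complex.sub_re] at h1
    have h2 : ‖∑ n ∈ Finset.range N, term (n + 1) y - ∑ n ∈ Finset.range N, term (n + 1) ((y₁ + y₂) / 2)‖ ≤
        D * ((y₂ - y₁) / 2) :=
      hL.trans (mul_le_mul hD hdist (abs_nonneg _) (hDnn.trans hD))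
    linarith [(abs_le.1 (h1.trans h2)).1]
  linarith [neg_abs_le (∑' n : ℕ, term (n + N + 1) y).re]

/-- **Negativity of `Re Φ_ℂ(iy)` on a cell** (same data, `S` an upper bound at the midpoint,
`S < −1/10⁷ − D·(y₂−y₁)/2`). [folklore] -/
theorem re_tsum_neg_on_cell {N : ℕ} (hN : 13 ≤ N + 1) {c₀ : ℝ} (hc₀ : 0 < c₀)
    (h8 : 8 ≤ π * c₀ * ((N + 1 : ℕ) : ℝ)) {y₁ y₂ : ℝ} (h12 : y₁ ≤ y₂)
    (hcos : ∀ t ∈ Icc y₁ y₂, c₀ ≤ Real.cos (4 * t)) {D S : ℝ}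
    (hD : ∑ n ∈ Finset.range N, dco (n + 1) * Real.exp (-(π * ((n + 1 : ℕ) : ℝ) ^ 2 * c₀)) ≤ D)
    (hS : (∑ n ∈ Finset.range N, term (n + 1) ((y₁ + y₂) / 2)).re ≤ S)
    (hmain : S < -(1 / 10 ^ 7) - D * ((y₂ - y₁) / 2)) :
    ∀ y ∈ Icc y₁ y₂, (∑' n : ℕ, term (n + 1) y).re < 0 := by
  intro y hy
  have hcy := hcos y hy
  obtain ⟨hsn, htail⟩ := tsum_norm_term_tail_le' hN hc₀ h8 hcy
  have hs := summable_term' hN hc₀ h8 hcy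
  rw [← hs.sum_add_tsum_nat_add N, Complex.add_re]
  have hsn' : Summable (fun n : ℕ ↦ ‖term (n + N + 1) y‖) := by simpa [add_assoc] using hsn
  have ht : |(∑' n : ℕ, term (n + N + 1) y).re| ≤ 1 / 10 ^ 7 :=
    calc |(∑' n : ℕ, term (n + N + 1) y).re| ≤ ‖∑' n : ℕ, term (n + N + 1) y‖ := Complex.abs_re_le_norm _
      _ ≤ ∑' n : ℕ, ‖term (n + N + 1) y‖ := norm_tsum_le_tsum_norm hsn'
      _ = ∑' j : ℕ, ‖term (j + (N + 1)) y‖ := by simp [add_assoc]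
      _ ≤ 1 / 10 ^ 7 := htail
  have hmid : (y₁ + y₂) / 2 ∈ Icc y₁ y₂ := ⟨by linarith, by linarith⟩
  have hL := norm_sum_term_sub_le N hcos hy hmid
  have hdist : |y - (y₁ + y₂) / 2| ≤ (y₂ - y₁) / 2 := by
    rw [abs_le]; constructor <;> linarith [hy.1, hy.2]
  have hDnn : 0 ≤ ∑ n ∈ Finset.range N, dco (n + 1) * Real.exp (-(π * ((n + 1 : ℕ) : ℝ) ^ 2 * c₀)) :=
    Finset.sum_nonneg fun n _ ↦ by simp only [dco]; positivity
  have hre : (∑ n ∈ Finset.range N, term (n + 1) y).re ≤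
      (∑ n ∈ Finset.range N, term (n + 1) ((y₁ + y₂) / 2)).re + D * ((y₂ - y₁) / 2) := by
    have h1 := Complex.abs_re_le_norm (∑ n ∈ Finset.range N, term (n + 1) y -
      ∑ n ∈ Finset.range N, term (n + 1) ((y₁ + y₂) / 2))
    rw [Complex.sub_re] at h1
    have h2 : ‖∑ n ∈ Finset.range N, term (n + 1) y - ∑ n ∈ Finset.range N, term (n + 1) ((y₁ + y₂) / 2)‖ ≤
        D * ((y₂ - y₁) / 2) :=
      hL.trans (mul_le_mul hD hdist (abs_nonneg _) (hDnn.trans hD))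
    linarith [(abs_le.1 (h1.trans h2)).2]
  linarith [le_abs_self (∑' n : ℕ, term (n + N + 1) y).re]

end UniversalFactor.PhiICert

end Summit.RiemannHypothesis.RiemannHypothesis.Theorems
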